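import Literature.NumberTheory.Automorphic.Liu2021.LemD1AsPrintedIndexedNonVacuityCharacterDecisionAllRanksAbelianization
import Literature.LinearAlgebra.Matrix.GeneralLinearGroupHomDet
import Literature.NumberTheory.Automorphic.UnitaryGroupSplitPlace
import HarnessLib

/-!
# [Liu2021, App. D Lemma D.1 (3)] bookkeeping — SPLIT places (`U(V)(F_v) ≅ GL_N(E_w)`): `U(V)(F_v)′ = SU(V)(F_v)` for EVERY `N ≥ 2`;
# hence at EVERY finite place (`N ≥ 3`): `U(V)(F_v)^{ab} ≅ E_v¹` via `det`, the characters of `U(V)(F_v)` ARE those of `E_v¹`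

Reproduction ∕ bookkeeping (Literature, THEOREMS ONLY: no definition, no record, no named fact, no `sorry`; nothing is
asserted about Liu's oscillator representations or about the tree's constructed local Weil carriers).

Sequel of ✔ `…CharacterDecisionAllRanksAbelianization` (NON-SPLIT places: `commutator S.U = ker det` from the isotropic unitary engine,
[Dieudonne1971GroupesClassiques, Chap. II §5]) for the place model `S = LemD1OfPlace.standingData` of [Liu2021, App. D §D.1]
(`U(V)(F_v) = S.U ≤ GL_N(E_v)`, `E_v = Π_{w ∣ v} E_w`, centre `E_v¹ = S.normOne`).  THIS FILE does the SPLIT places, where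
`U(V)(F_v) ≃ GL_N(E_w)` by the projection `g ↦ g_w` (✔ `UnitaryGroupSplitPlace.localSplitEquiv`, [Mok2014, §1]) and the relevant structure
theorem is `SL_N(K) ≤ GL_N(K)′` for `K ≠ 𝔽₂` (✔ `LinearAlgebra/Matrix/GeneralLinearGroupHomDet`: every homomorphism `GL_N(K) →* A` to a commutative
group kills `{det = 1}`, [Artin1988, Chap. IV Thm. 4.6]; [Dieudonne1971GroupesClassiques, Chap. II §1]),
and then assembles the EVERY-PLACE statements:

* §1 SPLIT `w ∣ v` (`c • w ≠ w`), ANY quadratic `E/F`, ANY hermitian non-degenerate `J`, EVERY `N ≥ 2`: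
  **`commutator_U_eq_ker_det_of_split`** (`U(V)(F_v)′ = SU(V)(F_v)`: a character kills `g` with `det g = 1` because `det g_w = (det g)_w = 1`
  and `SL_N(E_w) ≤ GL_N(E_w)′`), **`mem_commutator_U_iff_of_split`**, **`apply_eq_of_det_eq_of_split`**,
  **`existsUnique_normOne_factor_of_split`** (every `Ψ : S.U →* A` is `ψ ∘ det` for a UNIQUE `ψ : S.normOne →* A`),
  **`bijective_abelianization_det_of_split`** (`S.U^{ab} ≅ S.normOne`).
* §2 EVERY finite place, diagonal `J` of rank `N ≥ 3` over ANY quadratic `E/F`: **`commutator_U_eq_ker_det_of_diagonal'`**,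
  **`existsUnique_normOne_factor_of_diagonal'`**, **`bijective_abelianization_det_of_diagonal'`** (split: §1; non-split: ✔ the sibling).
* §3 EVERY finite place of `L⁺`, the CM rows, ANY hermitian non-degenerate `J_N` over a CM field `L`, `N ≥ 3`:
  **`commutator_U_eq_ker_det_of_isCMField'`**, **`apply_eq_of_det_eq_of_isCMField'`**, **`existsUnique_normOne_factor_of_isCMField'`**,
  **`bijective_abelianization_det_of_isCMField'`** — at EVERY finite place the group of one-dimensional characters of `U(V)(L⁺_v)` with
  values in any commutative `A` is `Hom(L_v¹, A)` through `det`, and `U(V)(L⁺_v)^{ab} ≅ L_v¹`.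

What this does NOT give: rank `N = 2` at non-split places; carriers of dimension `> 1`; the rows' OWN carriers `𝓢.omegaLoc v`; Lem. D.1 itself.
HC_CM is NOT proved.

Cell pub-hodgecm2 (COR-CM), audit class of the END rows `hD1''` ∕ `hD3`; seat prover-pub-hodgecm2-b10.

References: [Liu2021] Y. Liu, *Fourier–Jacobi cycles and arithmetic relative trace formula*, Camb. J. Math. 9 (2021) =
arXiv:2102.11518, App. D §D.1 (l. 5213–5221), Lemma D.1 (3) (l. 5233); [Dieudonne1971GroupesClassiques] J. Dieudonné, *La géométrie
des groupes classiques*, 3e éd. (1971), Chap. II §1 and §5; [Artin1988] E. Artin, *Geometric Algebra* (1957), Chap. IV Thm. 4.6; [Mok2014] C. P. Mok, Mem. AMS 235 (2015), §1 Notation p. 5 (`U(N)(F_v) ≅ GL_N`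
at split `v`); [Landherr1936HermitianForms] W. Landherr, Abh. Math. Sem. Hamburg 11 (1936).
-/

noncomputable section

open scoped Matrix MatrixGroups
open NumberField IsDedekindDomain
open Literature.RepresentationTheory
open Literature.RepresentationTheory.Liu2021 (OscillatorStandingData)
open Literature.NumberTheory.GaloisRepresentations (HeckeCharacter)

namespace Literature.NumberTheory.Automorphic.Liu2021.LemD1IndexedNonVacuityCharacterDecisionAllRanksAbelianizationSplit

open UnitaryGroup
open LemD1IndexedNonVacuityCharacterDecisionAllRanksAbelianization (range_det_eq_normOne det_comp_subtype_mem_normOne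
  commutator_U_eq_ker_det_of_diagonal existsUnique_normOne_factor_of_diagonal bijective_abelianization_det_of_diagonal
  commutator_U_eq_ker_det_of_isCMField apply_eq_of_det_eq_of_isCMField existsUnique_normOne_factor_of_isCMField
  bijective_abelianization_det_of_isCMField)

/-! ## §0 Pure group theory (private; copies of the sibling's lemmas) -/

section GroupTheory

variable {G M A : Type*} [Group G] [CommGroup M] [CommGroup A]

/-- If `S = T` as subgroups and every hom on `T` kills the elements satisfying `P`, so does every hom on `S`. [folklore] -/
private theorem kills_of_eq {H : Type*} [Group H] {S T : Subgroup H} (e : S = T) (P : H → Prop)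
    (hT : ∀ (θ' : ↥T →* A) (y : ↥T), P y.1 → θ' y = 1) (θ : ↥S →* A) (x : ↥S) (hx : P x.1) : θ x = 1 := by
  subst e
  exact hT θ x hx

/-- `commutator G = ker f` as soon as `ker f` dies in `G^{ab}`. [folklore] -/
private theorem commutator_eq_ker_of_kills (f : G →* M)
    (h : ∀ g : G, f g = 1 → (Abelianization.of g : Abelianization G) = 1) : commutator G = f.ker := by
  refine le_antisymm (Abelianization.commutator_subset_ker f) fun g hg => ?_
  have key := h g ((MonoidHom.mem_ker).1 hg)
  rwa [← MonoidHom.mem_ker, Abelianization.ker_of] at key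

/-- From `commutator G = ker f`: a homomorphism to a commutative group depends on `f` only. [folklore] -/
private theorem apply_eq_of_commutator_eq (f : G →* M) (hc : commutator G = f.ker) (χ : G →* A) (g h : G)
    (hgh : f g = f h) : χ g = χ h := by
  have hmem : g * h⁻¹ ∈ χ.ker := by
    refine Abelianization.commutator_subset_ker χ ?_
    rw [hc, MonoidHom.mem_ker, map_mul, map_inv, hgh, mul_inv_cancel]
  rwa [MonoidHom.mem_ker, map_mul, map_inv, mul_inv_eq_one] at hmem

/-- From `commutator G = ker f` and `f(G) = K`: every homomorphism to a commutative group is `ψ ∘ f` for a UNIQUE `ψ : K →* A`.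
[folklore] -/
private theorem existsUnique_factor_of_commutator_eq (f : G →* M) (hc : commutator G = f.ker) {K : Subgroup M}
    (hK : f.range = K) (χ : G →* A) : ∃! ψ : ↥K →* A, ∀ (g : G) (hg : f g ∈ K), χ g = ψ ⟨f g, hg⟩ := by
  subst hK
  have hsurj : Function.Surjective f.rangeRestrict := MonoidHom.rangeRestrict_surjective f
  have hker : f.rangeRestrict.ker ≤ χ.ker := by
    rw [MonoidHom.ker_rangeRestrict, ← hc]
    exact Abelianization.commutator_subset_ker χ
  refine ⟨MonoidHom.liftOfSurjective _ hsurj ⟨χ, hker⟩, fun g hg => ?_, fun ψ hψ => ?_⟩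
  · have h := MonoidHom.liftOfRightInverse_comp_apply f.rangeRestrict (Function.surjInv hsurj)
      (Function.rightInverse_surjInv hsurj) ⟨χ, hker⟩ g
    exact h.symm
  · ext y
    obtain ⟨g, rfl⟩ := hsurj y
    rw [MonoidHom.liftOfRightInverse_comp_apply]
    exact (hψ g ⟨g, rfl⟩).symm

/-- From `commutator G = ker f` and `f(G) ≤ K` with every element of `K` a value of `f`: `G^{ab} → K` is bijective. [folklore] -/
private theorem bijective_lift_of_commutator_eq (f : G →* M) (hc : commutator G = f.ker) {K : Subgroup M}
    (hmem : ∀ g, f g ∈ K) (hsurj : ∀ k : ↥K, ∃ g, f g = k) :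
    Function.Bijective (Abelianization.lift (f.codRestrict K hmem)) := by
  have hofs : Function.Surjective (Abelianization.of : G →* Abelianization G) :=
    fun x => QuotientGroup.induction_on x fun g => ⟨g, rfl⟩
  constructor
  · rw [← MonoidHom.ker_eq_bot_iff, eq_bot_iff]
    intro x hx
    obtain ⟨g, rfl⟩ := hofs x
    rw [MonoidHom.mem_ker, Abelianization.lift_apply_of] at hx
    have hg : g ∈ f.ker := by
      rw [MonoidHom.mem_ker]
      have h := congrArg (fun k : ↥K => (k : M)) hx
      simpa only [MonoidHom.codRestrict_apply, OneMemClass.coe_one] using h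
    rw [← hc, ← Abelianization.ker_of] at hg
    rw [Subgroup.mem_bot]
    exact (MonoidHom.mem_ker).1 hg
  · intro k
    obtain ⟨g, hg⟩ := hsurj k
    exact ⟨Abelianization.of g, by rw [Abelianization.lift_apply_of]; exact Subtype.ext hg⟩

end GroupTheory

/-! ## §1 SPLIT places: `U(V)(F_v) ≃ GL_N(E_w)` and `GL_N′ = SL_N` give `U(V)(F_v)′ = SU(V)(F_v)` for every `N ≥ 2` -/

section Split

variable {F : Type} (E : Type) [Field F] [NumberField F] [Field E] [NumberField E] [Algebra F E]
  [Algebra.IsQuadraticExtension F E] (v : HeightOneSpectrum (𝓞 F)) (c : E ≃ₐ[F] E)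
  {δ : E} (hcδ : c δ = -δ) (hδ : δ ≠ 0)
  (N : ℕ) (J : Matrix (Fin N) (Fin N) E) (hN : 2 ≤ N) (hJh : (J.map c)ᵀ = J) (hJdet : J.det ≠ 0)

omit [NumberField F] [Algebra.IsQuadraticExtension F E] in
include hcδ hδ in
/-- `c ≠ 1` (`c δ = −δ ≠ δ`); copy of the siblings' private lemma. [folklore] -/
private theorem hc_of_delta : c ≠ 1 := by
  rintro rfl
  rw [AlgEquiv.one_apply] at hcδ
  have h2 : (2 : E) * δ = 0 := by linear_combination hcδ
  exact hδ ((mul_eq_zero.mp h2).resolve_left two_ne_zero)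

include hcδ hδ hJh hJdet hN in
/-- SPLIT place: every homomorphism `S.U →* A` to ANY commutative group kills `{det = 1}` — through the isomorphism
`U(V)(F_v) ≃ GL_N(E_w)`, `g ↦ g_w` (✔ `localSplitEquiv`), whose image of `g` has determinant `(det g)_w = 1`, and every homomorphism
`GL_N(E_w) →* A` kills `{det = 1}` (✔ `GLHomDet.apply_eq_one_of_val_det_eq_one`; `E_w ⊇ E` is not `𝔽₂`). [cite: Mok2014, §1 Notation p. 5]
[cite: Artin1988, Chap. IV Thm. 4.6] -/
private theorem kills_of_split {A : Type*} [CommGroup A] (w : PlacesOver E v) (hw : c • w.1 ≠ w.1)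
    (Ψ : (LemD1OfPlace.standingData E v c N J hcδ hδ hN hJh hJdet).U →* A)
    (g : (LemD1OfPlace.standingData E v c N J hcδ hδ hN hJh hJdet).U)
    (hg : Matrix.GeneralLinearGroup.det (g : GL (Fin N) (LocalRing E v)) = 1) : Ψ g = 1 := by
  classical
  have hc : c ≠ 1 := hc_of_delta E c hcδ hδ
  have hJu : IsUnit J := (Matrix.isUnit_iff_isUnit_det J).2 (IsUnit.mk0 _ hJdet)
  have hJw : IsUnit (placeForm J w.1) := isUnit_placeForm J hJu w.1
  have hF : ∃ a : w.1.adicCompletion E, a ≠ 0 ∧ a ≠ 1 := by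
    refine ⟨2, ?_, fun h => one_ne_zero (α := w.1.adicCompletion E) (by linear_combination h)⟩
    rw [← map_ofNat (algebraMap E (w.1.adicCompletion E)) 2]
    exact (_root_.map_ne_zero _).2 two_ne_zero
  have hEq : (LemD1OfPlace.standingData E v c N J hcδ hδ hN hJh hJdet).U = «local» E c N J v :=
    Subgroup.ext fun x => LemD1OfPlace.mem_U_iff E v c N J hcδ hδ hN hJh hJdet x
  refine kills_of_eq hEq (fun y => Matrix.GeneralLinearGroup.det y = 1) ?_ Ψ g hg
  intro θ' y hy
  -- transport along `e : U(V)(F_v) ≃* GL_N(E_w)`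
  let e := (localSplitEquiv c J hc hJh w hw hJw).toMulEquiv
  have hθ : θ' y = (θ'.comp e.symm.toMonoidHom) (e y) := by
    rw [MonoidHom.comp_apply, MulEquiv.coe_toMonoidHom, MulEquiv.symm_apply_apply]
  rw [hθ]
  refine Literature.LinearAlgebra.Matrix.GLHomDet.apply_eq_one_of_val_det_eq_one hF _ ?_
  -- `det (g_w) = (det g)_w = 1`
  have hcoe : ((e y : GL (Fin N) (w.1.adicCompletion E)) : Matrix (Fin N) (Fin N) (w.1.adicCompletion E)) =
      ((y.1 : GL (Fin N) (LocalRing E v)) : Matrix (Fin N) (Fin N) (LocalRing E v)).map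
        (Pi.evalRingHom (fun w' : PlacesOver E v => w'.1.adicCompletion E) w) := rfl
  rw [hcoe, ← RingHom.mapMatrix_apply, ← RingHom.map_det]
  have h1 : ((y.1 : GL (Fin N) (LocalRing E v)) : Matrix (Fin N) (Fin N) (LocalRing E v)).det = 1 := by
    rw [← Matrix.GeneralLinearGroup.val_det_apply, hy, Units.val_one]
  rw [h1, map_one]

include hcδ hδ hJh hJdet hN in
/-- **`U(V)(F_v)′ = SU(V)(F_v)` at a SPLIT place** — ANY quadratic `E/F`, ANY hermitian non-degenerate `J`, EVERY rank `N ≥ 2`: the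
commutator subgroup of `S.U` is the kernel of `det : S.U →* E_vˣ`. [cite: Dieudonne1971GroupesClassiques, Chap. II §1] [cite: Mok2014, §1 Notation p. 5]
[cite: Liu2021, App. D §D.1 Step 3 (l. 5221)] -/
theorem commutator_U_eq_ker_det_of_split (w : PlacesOver E v) (hw : c • w.1 ≠ w.1) :
    commutator ↥(LemD1OfPlace.standingData E v c N J hcδ hδ hN hJh hJdet).U =
      (Matrix.GeneralLinearGroup.det.comp (LemD1OfPlace.standingData E v c N J hcδ hδ hN hJh hJdet).U.subtype).ker :=
  commutator_eq_ker_of_kills _ fun g hg =>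
    kills_of_split E v c hcδ hδ N J hN hJh hJdet w hw Abelianization.of g
      (by rw [MonoidHom.comp_apply, Subgroup.subtype_apply] at hg; exact hg)

include hN in
/-- **Membership form at a SPLIT place: `g ∈ U(V)(F_v)′ ↔ det g = 1`** (`N ≥ 2`). [cite: Dieudonne1971GroupesClassiques, Chap. II §1]
[cite: Liu2021, App. D §D.1 Step 3 (l. 5221)] -/
theorem mem_commutator_U_iff_of_split (w : PlacesOver E v) (hw : c • w.1 ≠ w.1)
    (g : (LemD1OfPlace.standingData E v c N J hcδ hδ hN hJh hJdet).U) :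
    g ∈ commutator ↥(LemD1OfPlace.standingData E v c N J hcδ hδ hN hJh hJdet).U ↔
      Matrix.GeneralLinearGroup.det (g : GL (Fin N) (LocalRing E v)) = 1 := by
  rw [commutator_U_eq_ker_det_of_split E v c hcδ hδ N J hN hJh hJdet w hw, MonoidHom.mem_ker, MonoidHom.comp_apply,
    Subgroup.subtype_apply]

include hN in
/-- **At a SPLIT place every homomorphism `U(V)(F_v) →* A` to a commutative group depends on `det` only** (`N ≥ 2`).
[cite: Dieudonne1971GroupesClassiques, Chap. II §1] [cite: Liu2021, App. D §D.1 Step 3 (l. 5221)] -/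
theorem apply_eq_of_det_eq_of_split {A : Type*} [CommGroup A] (w : PlacesOver E v) (hw : c • w.1 ≠ w.1)
    (Ψ : (LemD1OfPlace.standingData E v c N J hcδ hδ hN hJh hJdet).U →* A)
    (g h : (LemD1OfPlace.standingData E v c N J hcδ hδ hN hJh hJdet).U)
    (hgh : Matrix.GeneralLinearGroup.det (g : GL (Fin N) (LocalRing E v)) = Matrix.GeneralLinearGroup.det (h : GL (Fin N) (LocalRing E v))) :
    Ψ g = Ψ h :=
  apply_eq_of_commutator_eq _ (commutator_U_eq_ker_det_of_split E v c hcδ hδ N J hN hJh hJdet w hw) Ψ g h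
    (by rw [MonoidHom.comp_apply, MonoidHom.comp_apply, Subgroup.subtype_apply, Subgroup.subtype_apply]; exact hgh)

include hN in
/-- **At a SPLIT place the characters of `U(V)(F_v)` ARE the characters of `E_v¹`** (`N ≥ 2`; any commutative `A`): every
`Ψ : S.U →* A` is `ψ ∘ det` for a UNIQUE `ψ : S.normOne →* A`. [cite: Dieudonne1971GroupesClassiques, Chap. II §1]
[cite: Liu2021, App. D §D.1 Step 3 (l. 5221) and Lemma D.1 (3) (l. 5233)] -/
theorem existsUnique_normOne_factor_of_split {A : Type*} [CommGroup A] (w : PlacesOver E v) (hw : c • w.1 ≠ w.1)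
    (Ψ : (LemD1OfPlace.standingData E v c N J hcδ hδ hN hJh hJdet).U →* A) :
    ∃! ψ : ↥(LemD1OfPlace.standingData E v c N J hcδ hδ hN hJh hJdet).normOne →* A,
      ∀ (g : (LemD1OfPlace.standingData E v c N J hcδ hδ hN hJh hJdet).U)
        (hg : Matrix.GeneralLinearGroup.det (g : GL (Fin N) (LocalRing E v)) ∈
          (LemD1OfPlace.standingData E v c N J hcδ hδ hN hJh hJdet).normOne),
        Ψ g = ψ ⟨Matrix.GeneralLinearGroup.det (g : GL (Fin N) (LocalRing E v)), hg⟩ := by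
  have h := existsUnique_factor_of_commutator_eq _ (commutator_U_eq_ker_det_of_split E v c hcδ hδ N J hN hJh hJdet w hw)
    (range_det_eq_normOne E v c hcδ hδ N J hN hJh hJdet) Ψ
  simpa only [MonoidHom.comp_apply, Subgroup.subtype_apply] using h

include hN in
/-- **`U(V)(F_v)^{ab} ≅ E_v¹` at a SPLIT place** (`N ≥ 2`): `S.U^{ab} → S.normOne`, `[g] ↦ det g`, is BIJECTIVE.
[cite: Dieudonne1971GroupesClassiques, Chap. II §1] [cite: Liu2021, App. D §D.1 Step 3 (l. 5221)] -/
theorem bijective_abelianization_det_of_split (w : PlacesOver E v) (hw : c • w.1 ≠ w.1)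
    (hmem : ∀ g : (LemD1OfPlace.standingData E v c N J hcδ hδ hN hJh hJdet).U,
      (Matrix.GeneralLinearGroup.det.comp (LemD1OfPlace.standingData E v c N J hcδ hδ hN hJh hJdet).U.subtype) g ∈
        (LemD1OfPlace.standingData E v c N J hcδ hδ hN hJh hJdet).normOne) :
    Function.Bijective (Abelianization.lift
      ((Matrix.GeneralLinearGroup.det.comp (LemD1OfPlace.standingData E v c N J hcδ hδ hN hJh hJdet).U.subtype).codRestrict
        (LemD1OfPlace.standingData E v c N J hcδ hδ hN hJh hJdet).normOne hmem)) :=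
  bijective_lift_of_commutator_eq _ (commutator_U_eq_ker_det_of_split E v c hcδ hδ N J hN hJh hJdet w hw) hmem fun k => by
    obtain ⟨g, hg⟩ := LemD1IndexedNonVacuityDetCarrier.exists_mem_U_det_eq E v c hcδ hδ N J hN hJh hJdet k
    exact ⟨g, by rw [MonoidHom.comp_apply, Subgroup.subtype_apply]; exact hg⟩

end Split

/-! ## §2 EVERY finite place, diagonal `J` of rank `N ≥ 3` over ANY quadratic `E/F` -/

section Diagonal

variable {F : Type} (E : Type) [Field F] [NumberField F] [Field E] [NumberField E] [Algebra F E]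
  [Algebra.IsQuadraticExtension F E] (v : HeightOneSpectrum (𝓞 F)) (c : E ≃ₐ[F] E)
  {δ : E} (hcδ : c δ = -δ) (hδ : δ ≠ 0) {N : ℕ} (hN : 2 ≤ N) (hN3 : 3 ≤ N)
  (d : Fin N → E) (hJh : ((Matrix.diagonal d).map c)ᵀ = Matrix.diagonal d) (hJdet : (Matrix.diagonal d).det ≠ 0)

include hN3 in
/-- **`U(V)(F_v)′ = SU(V)(F_v)` at EVERY finite place** — ANY quadratic `E/F`, diagonal `J` of rank `N ≥ 3`, `w ∣ v` arbitrary (split: §1;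
non-split: ✔ `…AllRanksAbelianization.commutator_U_eq_ker_det_of_diagonal`). [cite: Dieudonne1971GroupesClassiques, Chap. II §1 and §5]
[cite: Liu2021, App. D §D.1 Step 3 (l. 5221)] -/
theorem commutator_U_eq_ker_det_of_diagonal' (w : PlacesOver E v) :
    commutator ↥(LemD1OfPlace.standingData E v c N (Matrix.diagonal d) hcδ hδ hN hJh hJdet).U =
      (Matrix.GeneralLinearGroup.det.comp (LemD1OfPlace.standingData E v c N (Matrix.diagonal d) hcδ hδ hN hJh hJdet).U.subtype).ker := by
  by_cases hw : c • w.1 = w.1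
  · exact commutator_U_eq_ker_det_of_diagonal E v c hcδ hδ hN hN3 d hJh hJdet w hw
  · exact commutator_U_eq_ker_det_of_split E v c hcδ hδ N (Matrix.diagonal d) hN hJh hJdet w hw

include hN3 in
/-- **At EVERY finite place the characters of `U(V)(F_v)` ARE the characters of `E_v¹`** (diagonal `J`, `N ≥ 3`; any commutative `A`).
[cite: Dieudonne1971GroupesClassiques, Chap. II §1 and §5] [cite: Liu2021, App. D §D.1 Step 3 (l. 5221) and Lemma D.1 (3) (l. 5233)] -/
theorem existsUnique_normOne_factor_of_diagonal' {A : Type*} [CommGroup A] (w : PlacesOver E v)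
    (Ψ : (LemD1OfPlace.standingData E v c N (Matrix.diagonal d) hcδ hδ hN hJh hJdet).U →* A) :
    ∃! ψ : ↥(LemD1OfPlace.standingData E v c N (Matrix.diagonal d) hcδ hδ hN hJh hJdet).normOne →* A,
      ∀ (g : (LemD1OfPlace.standingData E v c N (Matrix.diagonal d) hcδ hδ hN hJh hJdet).U)
        (hg : Matrix.GeneralLinearGroup.det (g : GL (Fin N) (LocalRing E v)) ∈
          (LemD1OfPlace.standingData E v c N (Matrix.diagonal d) hcδ hδ hN hJh hJdet).normOne),
        Ψ g = ψ ⟨Matrix.GeneralLinearGroup.det (g : GL (Fin N) (LocalRing E v)), hg⟩ := by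
  by_cases hw : c • w.1 = w.1
  · exact existsUnique_normOne_factor_of_diagonal E v c hcδ hδ hN hN3 d hJh hJdet w hw Ψ
  · exact existsUnique_normOne_factor_of_split E v c hcδ hδ N (Matrix.diagonal d) hN hJh hJdet w hw Ψ

include hN3 in
/-- **`U(V)(F_v)^{ab} ≅ E_v¹` at EVERY finite place** (diagonal `J`, `N ≥ 3`). [cite: Dieudonne1971GroupesClassiques, Chap. II §1 and §5]
[cite: Liu2021, App. D §D.1 Step 3 (l. 5221)] -/
theorem bijective_abelianization_det_of_diagonal' (w : PlacesOver E v)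
    (hmem : ∀ g : (LemD1OfPlace.standingData E v c N (Matrix.diagonal d) hcδ hδ hN hJh hJdet).U,
      (Matrix.GeneralLinearGroup.det.comp (LemD1OfPlace.standingData E v c N (Matrix.diagonal d) hcδ hδ hN hJh hJdet).U.subtype) g ∈
        (LemD1OfPlace.standingData E v c N (Matrix.diagonal d) hcδ hδ hN hJh hJdet).normOne) :
    Function.Bijective (Abelianization.lift
      ((Matrix.GeneralLinearGroup.det.comp (LemD1OfPlace.standingData E v c N (Matrix.diagonal d) hcδ hδ hN hJh hJdet).U.subtype).codRestrict
        (LemD1OfPlace.standingData E v c N (Matrix.diagonal d) hcδ hδ hN hJh hJdet).normOne hmem)) := by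
  by_cases hw : c • w.1 = w.1
  · exact bijective_abelianization_det_of_diagonal E v c hcδ hδ hN hN3 d hJh hJdet w hw hmem
  · exact bijective_abelianization_det_of_split E v c hcδ hδ N (Matrix.diagonal d) hN hJh hJdet w hw hmem

end Diagonal

/-! ## §3 EVERY finite place of `L⁺`: the CM rows, ANY hermitian `J_N` over a CM field `L`, `N ≥ 3` -/

section CM

open Literature.NumberTheory.GelbartRogawski1991.UnitaryDualPair (imagUnit complexConj_imagUnit imagUnit_ne_zero)

variable (L : Type) [Field L] [NumberField L] [IsCMField L]

local notation3 "cc" => (IsCMField.complexConj L)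
local notation3 "L⁺" => (↥(maximalRealSubfield L))

variable (v : HeightOneSpectrum (𝓞 (maximalRealSubfield L))) {N : ℕ} (hN : 2 ≤ N) (hN3 : 3 ≤ N)
  (J : Matrix (Fin N) (Fin N) L) (hJh : (J.map (IsCMField.complexConj L))ᵀ = J) (hJdet : J.det ≠ 0)

include hN3 in
/-- **`U(V)(L⁺_v)′ = SU(V)(L⁺_v)` at EVERY finite place of `L⁺`** — CM rows, ANY hermitian non-degenerate `J_N`, `N ≥ 3`, `w ∣ v` arbitrary.
[cite: Dieudonne1971GroupesClassiques, Chap. II §1 and §5] [cite: Landherr1936HermitianForms] [cite: Liu2021, App. D §D.1 Step 3 (l. 5221)] -/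
theorem commutator_U_eq_ker_det_of_isCMField' (w : PlacesOver L v) :
    commutator ↥(LemD1OfPlace.standingData L v cc N J (complexConj_imagUnit L) (imagUnit_ne_zero L) hN hJh hJdet).U =
      (Matrix.GeneralLinearGroup.det.comp
        (LemD1OfPlace.standingData L v cc N J (complexConj_imagUnit L) (imagUnit_ne_zero L) hN hJh hJdet).U.subtype).ker := by
  by_cases hw : cc • w.1 = w.1
  · exact commutator_U_eq_ker_det_of_isCMField L v hN hN3 J hJh hJdet w hw
  · exact commutator_U_eq_ker_det_of_split L v cc (complexConj_imagUnit L) (imagUnit_ne_zero L) N J hN hJh hJdet w hw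

include hN3 in
/-- **At EVERY finite place a homomorphism `U(V)(L⁺_v) →* A` to a commutative group depends on `det` only** (CM rows, any `J_N`, `N ≥ 3`).
[cite: Dieudonne1971GroupesClassiques, Chap. II §1 and §5] [cite: Liu2021, App. D §D.1 Step 3 (l. 5221)] -/
theorem apply_eq_of_det_eq_of_isCMField' {A : Type*} [CommGroup A] (w : PlacesOver L v)
    (Ψ : (LemD1OfPlace.standingData L v cc N J (complexConj_imagUnit L) (imagUnit_ne_zero L) hN hJh hJdet).U →* A)
    (g h : (LemD1OfPlace.standingData L v cc N J (complexConj_imagUnit L) (imagUnit_ne_zero L) hN hJh hJdet).U)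
    (hgh : Matrix.GeneralLinearGroup.det (g : GL (Fin N) (LocalRing L v)) = Matrix.GeneralLinearGroup.det (h : GL (Fin N) (LocalRing L v))) :
    Ψ g = Ψ h := by
  by_cases hw : cc • w.1 = w.1
  · exact apply_eq_of_det_eq_of_isCMField L v hN hN3 J hJh hJdet w hw Ψ g h hgh
  · exact apply_eq_of_det_eq_of_split L v cc (complexConj_imagUnit L) (imagUnit_ne_zero L) N J hN hJh hJdet w hw Ψ g h hgh

include hN3 in
/-- **At EVERY finite place of `L⁺` the characters of `U(V)(L⁺_v)` ARE the characters of `L_v¹`** (CM rows, ANY hermitian `J_N`, `N ≥ 3`;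
any commutative `A`): `Ψ = ψ ∘ det` for a UNIQUE `ψ : S.normOne →* A`.  The one-dimensional representation theory of `U(V)(L⁺_v)` entering the
[Lem. D.1 (3)] bookkeeping is that of the torus `L_v¹`, at every place. [cite: Dieudonne1971GroupesClassiques, Chap. II §1 and §5]
[cite: Liu2021, App. D §D.1 Step 3 (l. 5221) and Lemma D.1 (3) (l. 5233)] -/
theorem existsUnique_normOne_factor_of_isCMField' {A : Type*} [CommGroup A] (w : PlacesOver L v)
    (Ψ : (LemD1OfPlace.standingData L v cc N J (complexConj_imagUnit L) (imagUnit_ne_zero L) hN hJh hJdet).U →* A) :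
    ∃! ψ : ↥(LemD1OfPlace.standingData L v cc N J (complexConj_imagUnit L) (imagUnit_ne_zero L) hN hJh hJdet).normOne →* A,
      ∀ (g : (LemD1OfPlace.standingData L v cc N J (complexConj_imagUnit L) (imagUnit_ne_zero L) hN hJh hJdet).U)
        (hg : Matrix.GeneralLinearGroup.det (g : GL (Fin N) (LocalRing L v)) ∈
          (LemD1OfPlace.standingData L v cc N J (complexConj_imagUnit L) (imagUnit_ne_zero L) hN hJh hJdet).normOne),
        Ψ g = ψ ⟨Matrix.GeneralLinearGroup.det (g : GL (Fin N) (LocalRing L v)), hg⟩ := by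
  by_cases hw : cc • w.1 = w.1
  · exact existsUnique_normOne_factor_of_isCMField L v hN hN3 J hJh hJdet w hw Ψ
  · exact existsUnique_normOne_factor_of_split L v cc (complexConj_imagUnit L) (imagUnit_ne_zero L) N J hN hJh hJdet w hw Ψ

include hN3 in
/-- **`U(V)(L⁺_v)^{ab} ≅ L_v¹` at EVERY finite place of `L⁺`** (CM rows, ANY hermitian `J_N`, `N ≥ 3`): `S.U^{ab} → S.normOne`, `[g] ↦ det g`,
is BIJECTIVE. [cite: Dieudonne1971GroupesClassiques, Chap. II §1 and §5] [cite: Liu2021, App. D §D.1 Step 3 (l. 5221)] -/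
theorem bijective_abelianization_det_of_isCMField' (w : PlacesOver L v)
    (hmem : ∀ g : (LemD1OfPlace.standingData L v cc N J (complexConj_imagUnit L) (imagUnit_ne_zero L) hN hJh hJdet).U,
      (Matrix.GeneralLinearGroup.det.comp
          (LemD1OfPlace.standingData L v cc N J (complexConj_imagUnit L) (imagUnit_ne_zero L) hN hJh hJdet).U.subtype) g ∈
        (LemD1OfPlace.standingData L v cc N J (complexConj_imagUnit L) (imagUnit_ne_zero L) hN hJh hJdet).normOne) :
    Function.Bijective (Abelianization.lift
      ((Matrix.GeneralLinearGroup.det.comp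
          (LemD1OfPlace.standingData L v cc N J (complexConj_imagUnit L) (imagUnit_ne_zero L) hN hJh hJdet).U.subtype).codRestrict
        (LemD1OfPlace.standingData L v cc N J (complexConj_imagUnit L) (imagUnit_ne_zero L) hN hJh hJdet).normOne hmem)) := by
  by_cases hw : cc • w.1 = w.1
  · exact bijective_abelianization_det_of_isCMField L v hN hN3 J hJh hJdet w hw hmem
  · exact bijective_abelianization_det_of_split L v cc (complexConj_imagUnit L) (imagUnit_ne_zero L) N J hN hJh hJdet w hw hmem

end CM

end Literature.NumberTheory.Automorphic.Liu2021.LemD1IndexedNonVacuityCharacterDecisionAllRanksAbelianizationSplit
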